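import Summits.HubbardSuperconductivity.HubbardSuperconductivity.Theses.RelocationFloor
import HarnessLib

/-!
# Birth skeleton (BC3) for the crux `TransplantNondegeneracy` (stmt-HubbardSuperconductivity-18070; piece X₂ of the split of `B1gSignCoherence`, route `RelocationFloor`)

Line "ODLRO-scale floor + mass ceiling": `stub_farPairFloor` is the sign-free macroscopic floor
`c L² ≤ |Σ_x Re⟨ψ, A_{x,e}ᴴ A_{x+r,e'} ψ⟩|` for Bloch ground states at one point of the box (Yang's ODLRO
scale of the bond-pair two-point function, momentum/channel unspecified), `stub_massCeiling` the
provable-now contraction bound `Σ_x ‖A_{x,e}ᴴ A_{x+r,e'} ψ‖² ≤ L²` (annihilation operators are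
contractions); `TransplantNondegeneracy_of` composes them with `ε = c/2`.
-/

noncomputable section

set_option linter.dupNamespace false

namespace Summit.HubbardSuperconductivity.HubbardSuperconductivity.Cruxes.TransplantNondegeneracy.Birth

open Matrix Finset
open Literature.Probability.LatticeModels Literature.MathematicalPhysics.QuantumLattice
open Summit.HubbardSuperconductivity.HubbardSuperconductivity.Theses.RelocationFloor

/-- STUB A (far pair floor, sign-free): at one point of the box, far translation-summed bond-pair
correlations of Bloch ground states are macroscopic in absolute value. [difficulty: open-problem] -/
theorem stub_farPairFloor : ∃ U ∈ Set.Icc (2 : ℝ) 5, ∃ δ ∈ Set.Icc (1 / 5 : ℝ) (3 / 10), ∃ c : ℝ, 0 < c ∧ ∃ R L₀ : ℕ, ∀ (L : ℕ) [NeZero L], L₀ ≤ L → Even L → ∀ ψ : Fock (Orb (FermionTorus 2 L)), star ψ ⬝ᵥ ψ = 1 → IsGroundStateInSector (hubbardTorus 2 L 1 U) (2 * ⌊(1 - δ) * (L : ℝ) ^ 2 / 2⌋₊) 0 ψ → (∀ v : TorusSite 2 L, ∃ c : ℂ, (fockTranslate v).val *ᵥ ψ = c • ψ) → ∀ r : TorusSite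 2 L, R ≤ torusDist r 0 → ∀ e ∈ unitSteps, ∀ e' ∈ unitSteps, let A : TorusSite 2 L → Site 2 → Matrix (Finset (Orb (FermionTorus 2 L))) (Finset (Orb (FermionTorus 2 L))) ℂ := fun x u => annihilation (orb (FermionTorus.ofTorusSite x) 0) * annihilation (orb (FermionTorus.ofTorusSite (x + Torus.proj L u)) 1); let φ : TorusSite 2 L → Fock (Orb (FermionTorus 2 L)) := fun x => ((A x e)ᴴ * A (x + r) e') *ᵥ ψ; c * (L : ℝ) ^ 2 ≤ |∑ x : TorusSite 2 L, (star ψ ⬝ᵥ φ x).re| := by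
  sorry

/-- STUB B (mass ceiling, provable now): the translation-summed transplant mass is at most `L²`
(`‖c c c† c† … ψ‖ ≤ ‖ψ‖`, annihilation operators are contractions). [difficulty: provable-now] -/
theorem stub_massCeiling : ∀ (L : ℕ) [NeZero L] (ψ : Fock (Orb (FermionTorus 2 L))), star ψ ⬝ᵥ ψ = 1 → ∀ (r : TorusSite 2 L) (e e' : Site 2), let A : TorusSite 2 L → Site 2 → Matrix (Finset (Orb (FermionTorus 2 L))) (Finset (Orb (FermionTorus 2 L))) ℂ := fun x u => annihilation (orb (FermionTorus.ofTorusSite x) 0) * annihilation (orb (FermionTorus.ofTorusSite (x + Torus.proj L u)) 1); let φ : TorusSite 2 L → Fock (Orb (FermionTorus 2 L)) := fun x => ((A x e)ᴴ * A (x + r) e') *ᵥ ψ; ∑ x : TorusSite 2 L, (star (φ x) ⬝ᵥ φ x).re ≤ (L : ℝ) ^ 2 := by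
  sorry

/-- Composition: floor `c L² ≤ |S|` and ceiling `Q ≤ L²` give `2 (c/2) Q ≤ |S|`, i.e.
`TransplantNondegeneracy` (by name) with `ε = c / 2`. [folklore] -/
theorem TransplantNondegeneracy_of : (∃ U ∈ Set.Icc (2 : ℝ) 5, ∃ δ ∈ Set.Icc (1 / 5 : ℝ) (3 / 10), ∃ c : ℝ, 0 < c ∧ ∃ R L₀ : ℕ, ∀ (L : ℕ) [NeZero L], L₀ ≤ L → Even L → ∀ ψ : Fock (Orb (FermionTorus 2 L)), star ψ ⬝ᵥ ψ = 1 → IsGroundStateInSector (hubbardTorus 2 L 1 U) (2 * ⌊(1 - δ) * (L : ℝ) ^ 2 / 2⌋₊) 0 ψ → (∀ v : TorusSite 2 L, ∃ c : ℂ, (fockTranslate v).val *ᵥ ψ = c • ψ) → ∀ r : TorusSite 2 L, R ≤ torusDist r 0 → ∀ e ∈ unitSteps, ∀ e' ∈ unitSteps, let A : TorusSite 2 L → Site 2 → Matrix (Finset (Orb (FermionTorus 2 L))) (Finset (Orb (FermionTorus 2 L))) ℂ := fun x u => annihilation (orb (FermionTorus.ofTorusSite x) 0) * annihilation (orb (FermionTorus.ofTorusSite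 (x + Torus.proj L u)) 1); let φ : TorusSite 2 L → Fock (Orb (FermionTorus 2 L)) := fun x => ((A x e)ᴴ * A (x + r) e') *ᵥ ψ; c * (L : ℝ) ^ 2 ≤ |∑ x : TorusSite 2 L, (star ψ ⬝ᵥ φ x).re|) → (∀ (L : ℕ) [NeZero L] (ψ : Fock (Orb (FermionTorus 2 L))), star ψ ⬝ᵥ ψ = 1 → ∀ (r : TorusSite 2 L) (e e' : Site 2), let A : TorusSite 2 L → Site 2 → Matrix (Finset (Orb (FermionTorus 2 L))) (Finset (Orb (FermionTorus 2 L))) ℂ := fun x u => annihilation (orb (FermionTorus.ofTorusSite x) 0) * annihilation (orb (FermionTorus.ofTorusSite (x + Torus.proj L u)) 1); let φ : TorusSite 2 L → Fock (Orb (FermionTorus 2 L)) := fun x => ((A x e)ᴴ * A (x + r) e') *ᵥ ψ; ∑ x : TorusSite 2 L, (star (φ x) ⬝ᵥ φ x).re ≤ (L : ℝ) ^ 2) → (∃ U ∈ Set.Icc (2 : ℝ) 5, ∃ δ ∈ Set.Icc (1 / 5 : ℝ) (3 / 10), ∃ ε : ℝ, 0 < ε ∧ ∃ R L₀ : ℕ,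 ∀ (L : ℕ) [NeZero L], L₀ ≤ L → Even L → ∀ ψ : Fock (Orb (FermionTorus 2 L)), star ψ ⬝ᵥ ψ = 1 → IsGroundStateInSector (hubbardTorus 2 L 1 U) (2 * ⌊(1 - δ) * (L : ℝ) ^ 2 / 2⌋₊) 0 ψ → (∀ v : TorusSite 2 L, ∃ c : ℂ, (fockTranslate v).val *ᵥ ψ = c • ψ) → ∀ r : TorusSite 2 L, R ≤ torusDist r 0 → ∀ e ∈ unitSteps, ∀ e' ∈ unitSteps, let A : TorusSite 2 L → Site 2 → Matrix (Finset (Orb (FermionTorus 2 L))) (Finset (Orb (FermionTorus 2 L))) ℂ := fun x u => annihilation (orb (FermionTorus.ofTorusSite x) 0) * annihilation (orb (FermionTorus.ofTorusSite (x + Torus.proj L u)) 1); let φ : TorusSite 2 L → Fock (Orb (FermionTorus 2 L)) := fun x => ((A x e)ᴴ * A (x + r) e') *ᵥ ψ; 2 * ε * (∑ x : TorusSite 2 L, (star (φ x) ⬝ᵥ φ x).re) ≤ |∑ x : TorusSite 2 L, (star ψ ⬝ᵥ φ x).re|) := by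
  intro hF hM
  obtain ⟨U, hU, δ, hδ, c, hc, R, L₀, hF⟩ := hF
  refine ⟨U, hU, δ, hδ, c / 2, by positivity, R, L₀, ?_⟩
  intro L _ hL hE ψ hψ hgs hb r hr e he e' he'
  set A : TorusSite 2 L → Site 2 → Matrix (Finset (Orb (FermionTorus 2 L))) (Finset (Orb (FermionTorus 2 L))) ℂ :=
    fun x u => annihilation (orb (FermionTorus.ofTorusSite x) 0) *
      annihilation (orb (FermionTorus.ofTorusSite (x + Torus.proj L u)) 1) with hAdef
  set T : TorusSite 2 L → Matrix (Finset (Orb (FermionTorus 2 L))) (Finset (Orb (FermionTorus 2 L))) ℂ :=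
    fun x => (A x e)ᴴ * A (x + r) e' with hTdef
  have hF' : c * (L : ℝ) ^ 2 ≤ |∑ x : TorusSite 2 L, (star ψ ⬝ᵥ (T x *ᵥ ψ)).re| :=
    hF L hL hE ψ hψ hgs hb r hr e he e' he'
  have hM' : ∑ x : TorusSite 2 L, (star (T x *ᵥ ψ) ⬝ᵥ (T x *ᵥ ψ)).re ≤ (L : ℝ) ^ 2 := hM L ψ hψ r e e'
  show 2 * (c / 2) * (∑ x : TorusSite 2 L, (star (T x *ᵥ ψ) ⬝ᵥ (T x *ᵥ ψ)).re) ≤ |∑ x : TorusSite 2 L, (star ψ ⬝ᵥ (T x *ᵥ ψ)).re|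
  nlinarith

/-- **The crux BY NAME from the two named stubs** (hypothesis-free form; its only `sorry`s are the
stubs'; this is the theorem `#h21_check_skeleton` registers — `TransplantNondegeneracy_of` below it has the BC3 shape
`stub-statements → crux-statement` with the crux statement spelled out, so that it is not a by-name candidate). [folklore] -/
theorem TransplantNondegeneracy_of_stubs : TransplantNondegeneracy :=
  TransplantNondegeneracy_of stub_farPairFloor stub_massCeiling

end Summit.HubbardSuperconductivity.HubbardSuperconductivity.Cruxes.TransplantNondegeneracy.Birth
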